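import Summits.CriticalPhenomena.PercolationContinuityZ3.Theorems.Transplant.CayleyNilThreeQuotients
import Summits.CriticalPhenomena.PercolationContinuityZ3.Theorems.Transplant.CayleySkeletonCore
import HarnessLib

/-!
# Class-≤3 central quotients `N_{m+2,c+1} ⧸ K` with the letters AND arbitrary inversion-stable unit-range extras: `θ(p_c) = 0`, unconditionally

builds on p205010 (kernel theorem, internal audit signed; external expert review pending) — through the closed one-type `{±1}` node, gen 11's
class-3 connected-cylinder criterion and gen 13's core/superset monotonicity (`theta_eq_zero_of_le_core`, file `CayleySkeletonCore`).  Lane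
`prim-bschramm`, seat `prim-bschramm-p4` gen 13 (PART C3 of `P4-GENERAL.md` §35.7/§35.10).  Helper file (`--supports stmt-CriticalPhenomena-4575 --as helper`).

Gen 12's `FreeNilClass.CQuot.theta_eq_zero_of_le` (p337222) is the LETTERS-ONLY row of the ν-stable central quotients `N_{m+2,c+1} ⧸ K` of class ≤ 3
(`K ≤ γ₂`, `ν(K) ⊆ K`; e.g. every `K ≤ γ₃(N_{m+2,3})`).  By monotonicity of the connected unit cylinder in the alphabet the letters may be ENLARGED by any
unit-range words: **`CQuot.theta_eq_zero_of_le_core` — for every such quotient and EVERY finite `S ⊇ AQ K` (the letter images) of unit range under the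
letter chart `φQ` and stable under the descended letter inversion `νQ`, `θ_g(p) = 0 ∀ p ≤ p_c` on `Cay(N_{m+2,c+1} ⧸ K; S)`** — e.g. letters plus all
products of two distinct letters (`νQ(a_i a_j) = (a_j a_i)⁻¹`).  In class 3 the letters-type CORE is essential (doubled / diagonal charts WITHOUT the
pure letters can disconnect the cylinder: P4-GENERAL §35.8, GAP j174868); the extras ride on it.
[cite: BenjaminiSchramm1996, Conj. 4; §2 (Cayley graphs)] [cite: KozmaNitzan2024, §4 p. 16 (Lemma 8)]
-/

noncomputable section

namespace Summit.CriticalPhenomena.PercolationContinuityZ3.Theorems.Transplant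

open SimpleGraph Subgroup Literature.Probability.LatticeModels Literature.Probability.Percolation
open scoped commutatorElement Classical

namespace FreeNilClass

namespace CQuot

variable {m c : ℕ} (K : Subgroup (N m c)) [K.Normal] (hK : K ≤ (⊤ : Subgroup (N m c)).lowerCentralSeries 1) (hν : ∀ k ∈ K, ν m c k ∈ K)

/-- **THEOREM (UNCONDITIONAL; class ≤ 3 ν-stable central quotients, letters + inversion-stable unit-range extras): `θ_g(p) = 0` for every
`p ≤ p_c` at every vertex of `Cay(N_{m+2,c+1} ⧸ K; S)`** for `N_{m+2,c+1}` of class ≤ 3, `K ≤ γ₂` with `ν(K) ⊆ K`, and every finite `S ⊇ AQ K` with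
`‖φQ(S)‖_∞ ≤ 1` and `νQ(S) = S`. builds on p205010 (kernel theorem, internal audit signed; external expert review pending). [cite: BenjaminiSchramm1996, Conj. 4; §2] -/
theorem theta_eq_zero_of_le_core (h3 : (⊤ : Subgroup (N m c)).lowerCentralSeries 3 = ⊥) (S : Finset (N m c ⧸ K)) (hsub : AQ K ⊆ S)
    (hr : ∀ s ∈ S, ∀ i : Fin 2, |φQ K hK s i| ≤ 1) (hνS : ∀ s, νQ K hν s ∈ S ↔ s ∈ S) (g : N m c ⧸ K) {p : unitInterval}
    (hp : (p : ℝ) ≤ criticalProb (mulCayley (↑S : Set (N m c ⧸ K))) g) : theta (mulCayley (↑S : Set (N m c ⧸ K))) g p = 0 :=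
  Transplant.theta_eq_zero_of_le_core (negData K hK hν h3).cayleyNeg₂.toFrm₂ hsub hr (νQ K hν) hνS (φQ_νQ K hK hν) g hp

/-- **`θ_g(p_c) = 0` on `Cay(N_{m+2,c+1} ⧸ K; S)`** for every such alphabet (the `p = p_c` case).
builds on p205010 (kernel theorem, internal audit signed; external expert review pending). [cite: BenjaminiSchramm1996, Conj. 4; §2] -/
theorem criticalContinuity_core (h3 : (⊤ : Subgroup (N m c)).lowerCentralSeries 3 = ⊥) (S : Finset (N m c ⧸ K)) (hsub : AQ K ⊆ S)
    (hr : ∀ s ∈ S, ∀ i : Fin 2, |φQ K hK s i| ≤ 1) (hνS : ∀ s, νQ K hν s ∈ S ↔ s ∈ S) (g : N m c ⧸ K) :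
    theta (mulCayley (↑S : Set (N m c ⧸ K))) g (criticalProbIOf (mulCayley (↑S : Set (N m c ⧸ K))) g) = 0 :=
  theta_eq_zero_of_le_core K hK hν h3 S hsub hr hνS g le_rfl

end CQuot

end FreeNilClass

end Summit.CriticalPhenomena.PercolationContinuityZ3.Theorems.Transplant

end
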